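import Literature.Topology.FourManifolds.PlumbingLevelStructure
import Literature.Topology.FourManifolds.SphereCapComplement
import HarnessLib

/-!
# The pieces of the boundary `∂M(4m) = {ρ = ε}` in the tubes `Sᵏ × Sᵏ`

Topic `Literature/Topology/FourManifolds`; part of the construction of Kosinski's `M(4m)`
(A. Kosinski, *Differential Manifolds* (1993), VI.12), towards VI.(12.1): `π₁(∂M(4m)) = 1` for
`k > 2`. The level `{ρ = ε}` is covered by the eight **vertex pieces** — the parts of the level
lying in the `v`-th tube over the good base region `B̂ᵥ` (`Plumbing.goodBase`) — and two such
pieces meet exactly in the **square pieces** over the plumbing squares. This file computes the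
topology of both kinds of pieces inside one tube `Sᵏ × Sᵏ`:

* `Plumbing.hatS v ε = {(p, q) | p ∈ B̂ᵥ, ⟪p, q⟫ > c, b(p, q) = β̂ᵥ(p)}` (the vertex piece in the
  tube) is **homeomorphic to `B̂ᵥ × S^{k-1}`** (`Plumbing.vertexTriv`: transport the fibre point
  by the rotation `rotTo p h` taking `p` to a fixed hub `h = -e_{j₀}` and normalise its component
  orthogonal to `h`), hence **simply connected** for `k ≥ 3` and `ε ≤ 1/4`
  (`Plumbing.isSimplyConnected_hatS`; `B̂ᵥ` is a sphere minus `≤ 3` separated caps,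
  `SphereCaps.isSimplyConnected_forall_inner_lt`, and `S^{k-1}` is a great sphere,
  `SphereCaps.simplyConnectedSpace_greatSphere`);
* `Plumbing.sqS e ε = {(p, q) ∈ D_e(c) | a > ε, b > ε, G(a, b) = ε}` (the square piece) is
  **path connected** (`Plumbing.isPathConnected_sqS`): it is the continuous image, under the
  inverse polar chart `Plumbing.unkap`, of `J × S^{k-1} × S^{k-1}` where
  `J = {a | ε < a < r², β(a) > ε}` is an interval (`β` is antitone, `betaFn_antitoneOn`) which is
  nonempty (`lt_betaFn_wedgePt`).

Everything is proved; no named facts (D-0026).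

## References

* A. Kosinski, *Differential Manifolds*, Academic Press 1993, VI.12, (12.1). [Kosinski1993]
-/

open scoped Manifold ContDiff Topology RealInnerProductSpace
open Set Function Module Filter Metric

noncomputable section

namespace Literature.Topology.FourManifolds

namespace Plumbing

open SphereCaps

/-- Local notation: `𝔼 n` is the model Euclidean space `EuclideanSpace ℝ (Fin n)`. -/
local notation "𝔼 " n:arg => EuclideanSpace ℝ (Fin n)

/-- Local notation: `𝕊 n` is the unit sphere in `EuclideanSpace ℝ (Fin (n + 1))`. -/
local notation "𝕊 " n:arg => (Metric.sphere (0 : EuclideanSpace ℝ (Fin (n + 1))) 1)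

variable {k : ℕ} {c : ℝ}

/-! ### §1 The vertex piece over the good base region -/

section Vertex

/-- A chosen neighbour of the vertex `v` in the `E₈` tree. [folklore] -/
def nbr (v : Fin 8) : Fin 8 := (nbrs_nonempty v).choose

/-- `gamma8_nbr` (gamma8 nbr). [folklore] -/
theorem gamma8_nbr (v : Fin 8) : kosinskiGamma8 v (nbr v) = 1 := by
  have := (nbrs_nonempty v).choose_spec
  rw [Finset.mem_filter] at this
  exact this.2

variable (k) in
/-- **The hub** of the `v`-th tube: the antipode `-e_{j₀}` of one active pole; every point of the
good base region is `≠ e_{j₀}`, so the transport rotation `rotTo p (hub v)` is defined there.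
[folklore] -/
def hub (v : Fin 8) : 𝔼 (k + 1) := -(pole k (ecol v (nbr v)).val : 𝔼 (k + 1))

/-- `norm_hub` (norm hub). [folklore] -/
theorem norm_hub (v : Fin 8) : ‖hub k v‖ = 1 := by rw [hub, norm_neg, norm_eq_of_mem_sphere]

/-- `hub_ne_zero` (hub ne zero). [folklore] -/
theorem hub_ne_zero (v : Fin 8) : hub k v ≠ 0 := by
  rw [← norm_ne_zero_iff, norm_hub]; exact one_ne_zero

/-- `√(1 - ε) ≤ 1` for `0 ≤ ε`. [folklore] -/
theorem sqrt_one_sub_le_one {ε : ℝ} (hε : 0 ≤ ε) : Real.sqrt (1 - ε) ≤ 1 := by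
  rw [Real.sqrt_le_one]; linarith

/-- On the good base region, `p + hub ≠ 0` (`p ≠ e_{j₀}`). [folklore] -/
theorem add_hub_ne_zero (v : Fin 8) {ε : ℝ} (hε : 0 ≤ ε) {p : 𝕊 k} (hp : p ∈ goodBase k v ε) :
    (p : 𝔼 (k + 1)) + hub k v ≠ 0 := by
  intro h0
  have hp' : (p : 𝔼 (k + 1)) = (pole k (ecol v (nbr v)).val : 𝔼 (k + 1)) := by
    rw [hub] at h0; exact eq_of_sub_eq_zero (by rwa [sub_eq_add_neg])
  have h1 := hp (nbr v) (gamma8_nbr v)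
  rw [hp', real_inner_self_eq_norm_sq, norm_eq_of_mem_sphere, one_pow] at h1
  linarith [sqrt_one_sub_le_one hε]

variable (k c) in
/-- **The vertex piece in the tube**: the part of the level `{ρ̂ᵥ = ε}` of the `v`-th tube over the
good base region, `{(p, q) | p ∈ B̂ᵥ, ⟪p, q⟫ > c, b(p, q) = β̂ᵥ(p)}`. [folklore] -/
def hatS (v : Fin 8) (ε : ℝ) : Set ((𝕊 k) × (𝕊 k)) :=
  {pq | pq.1 ∈ goodBase k v ε ∧ c < fibHt pq ∧ bFn pq = levelRad k c v ε pq.1}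

/-- The transported fibre point `w = rotTo p h q` has height `⟪w, h⟫ = ⟪p, q⟫`. [folklore] -/
theorem inner_rotTo_hub (v : Fin 8) {pq : (𝕊 k) × (𝕊 k)} (h0 : (pq.1 : 𝔼 (k + 1)) + hub k v ≠ 0) :
    ⟪rotTo (pq.1 : 𝔼 (k + 1)) (hub k v) pq.2, hub k v⟫ = fibHt pq := by
  have hpe : ‖(pq.1 : 𝔼 (k + 1))‖ = ‖hub k v‖ := by rw [norm_eq_of_mem_sphere, norm_hub]
  calc ⟪rotTo (pq.1 : 𝔼 (k + 1)) (hub k v) pq.2, hub k v⟫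
        = ⟪rotTo (pq.1 : 𝔼 (k + 1)) (hub k v) pq.2, rotTo (pq.1 : 𝔼 (k + 1)) (hub k v) pq.1⟫ := by
          rw [rotTo_self hpe h0]
    _ = fibHt pq := by rw [inner_rotTo_rotTo, fibHt_apply, real_inner_comm]

/-- The component of `w` orthogonal to the hub has squared norm `b(p, q)`. [folklore] -/
theorem norm_perp_rotTo_hub_sq (v : Fin 8) {pq : (𝕊 k) × (𝕊 k)} (h0 : (pq.1 : 𝔼 (k + 1)) + hub k v ≠ 0) :
    ‖perp (hub k v) (rotTo (pq.1 : 𝔼 (k + 1)) (hub k v) pq.2)‖ ^ 2 = bFn pq := by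
  rw [norm_perp_sq (norm_hub v), norm_rotTo, norm_eq_of_mem_sphere pq.2, one_pow, inner_rotTo_hub v h0,
    bFn_apply]

variable (k c) in
/-- **The fibre coordinate** of the vertex trivialisation: the normalised component of
`rotTo p h q` orthogonal to the hub. [folklore] -/
def fibCoord (v : Fin 8) (pq : (𝕊 k) × (𝕊 k)) : 𝔼 (k + 1) :=
  (Real.sqrt (bFn pq))⁻¹ • perp (hub k v) (rotTo (pq.1 : 𝔼 (k + 1)) (hub k v) pq.2)

/-- The fibre coordinate lies on the great sphere orthogonal to the hub (`b > 0`). [folklore] -/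
theorem fibCoord_mem (v : Fin 8) {pq : (𝕊 k) × (𝕊 k)} (h0 : (pq.1 : 𝔼 (k + 1)) + hub k v ≠ 0)
    (hb : 0 < bFn pq) : fibCoord k v pq ∈ greatSphere (hub k v) := by
  have hn : ‖perp (hub k v) (rotTo (pq.1 : 𝔼 (k + 1)) (hub k v) pq.2)‖ = Real.sqrt (bFn pq) := by
    rw [← norm_perp_rotTo_hub_sq v h0, Real.sqrt_sq (norm_nonneg _)]
  have hs : 0 < Real.sqrt (bFn pq) := Real.sqrt_pos.2 hb
  refine ⟨?_, ?_⟩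
  · rw [fibCoord, norm_smul, norm_inv, Real.norm_of_nonneg hs.le, hn, inv_mul_cancel₀ hs.ne']
  · rw [fibCoord, real_inner_smul_left, inner_perp_left (norm_hub v), mul_zero]

variable (k c) in
/-- **The inverse of the vertex trivialisation** on vectors: `(p, u) ↦ rotFrom p h (√(1 - β̂(p)) h + √β̂(p) u)`.
[folklore] -/
def liftVec (v : Fin 8) (ε : ℝ) (p : 𝕊 k) (u : 𝔼 (k + 1)) : 𝔼 (k + 1) :=
  rotFrom (p : 𝔼 (k + 1)) (hub k v)
    (Real.sqrt (1 - levelRad k c v ε p) • hub k v + Real.sqrt (levelRad k c v ε p) • u)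

section LiftVec

variable (hk : 2 ≤ k) (hc : IsParam c) (v : Fin 8) {ε : ℝ} (hε : 0 < ε) (hεR : ε < rsq c)
include hk hc hε hεR

/-- Properties of the lifted vector for `p ∈ B̂ᵥ`, `u` on the great sphere: it is a unit vector with
`⟪p, ·⟫ = √(1 - β̂(p)) > c`, squared fibre radius `β̂(p)`, and fibre coordinate `u`. [folklore] -/
theorem liftVec_spec {p : 𝕊 k} (hp : p ∈ goodBase k v ε) {u : 𝔼 (k + 1)} (hu : u ∈ greatSphere (hub k v)) :
    ‖liftVec k c v ε p u‖ = 1 ∧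
    ⟪(p : 𝔼 (k + 1)), liftVec k c v ε p u⟫ = Real.sqrt (1 - levelRad k c v ε p) ∧
    c < Real.sqrt (1 - levelRad k c v ε p) ∧
    perp (hub k v) (rotTo (p : 𝔼 (k + 1)) (hub k v) (liftVec k c v ε p u)) = Real.sqrt (levelRad k c v ε p) • u := by
  set β := levelRad k c v ε p with hβ
  have hcap := lt_capA hk hc v hεR hp
  have hβpos : 0 < β := levelRad_pos hc v hε hcap
  have hβR : β < rsq c := levelRad_lt_rsq hc v hε hcap
  have hβ1 : β < 1 := hβR.trans_le (by rw [rsq]; nlinarith [hc.nonneg])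
  have h0 := add_hub_ne_zero v hε.le hp
  have hh := norm_hub (k := k) v
  have hpe : ‖(p : 𝔼 (k + 1))‖ = ‖hub k v‖ := by rw [norm_eq_of_mem_sphere, hh]
  set z := Real.sqrt (1 - β) • hub k v + Real.sqrt β • u with hz
  have hhh : ⟪hub k v, hub k v⟫ = 1 := by rw [real_inner_self_eq_norm_sq, hh, one_pow]
  have huh : ⟪u, hub k v⟫ = 0 := hu.2
  have hhu : ⟪hub k v, u⟫ = 0 := by rw [real_inner_comm]; exact huh
  have huu : ⟪u, u⟫ = 1 := by rw [real_inner_self_eq_norm_sq, hu.1, one_pow]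
  have hzn : ‖z‖ = 1 := by
    have h2 : ‖z‖ ^ 2 = 1 := by
      rw [← real_inner_self_eq_norm_sq, hz]
      simp only [inner_add_left, inner_add_right, real_inner_smul_left, real_inner_smul_right, hhh, huh,
        hhu, huu, mul_zero, add_zero, zero_add, mul_one]
      have hs1 : Real.sqrt (1 - β) * Real.sqrt (1 - β) = 1 - β := Real.mul_self_sqrt (by linarith)
      have hs2 : Real.sqrt β * Real.sqrt β = β := Real.mul_self_sqrt hβpos.le
      linarith
    have h0' : 0 ≤ ‖z‖ := norm_nonneg _
    nlinarith
  have hzh : ⟪hub k v, z⟫ = Real.sqrt (1 - β) := by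
    rw [hz, inner_add_right, real_inner_smul_right, real_inner_smul_right, hhh, hhu]; ring
  refine ⟨?_, ?_, ?_, ?_⟩
  · rw [liftVec, norm_rotFrom]; exact hzn
  · rw [liftVec, ← hz]
    calc ⟪(p : 𝔼 (k + 1)), rotFrom (p : 𝔼 (k + 1)) (hub k v) z⟫
          = ⟪rotFrom (p : 𝔼 (k + 1)) (hub k v) (hub k v), rotFrom (p : 𝔼 (k + 1)) (hub k v) z⟫ := by
            rw [rotFrom_pole hpe h0]
      _ = Real.sqrt (1 - β) := by rw [inner_rotFrom_rotFrom, hzh]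
  · calc c = Real.sqrt (c ^ 2) := (Real.sqrt_sq hc.nonneg).symm
      _ < Real.sqrt (1 - β) := Real.sqrt_lt_sqrt (sq_nonneg _) (by rw [rsq] at hβR; linarith)
  · rw [liftVec, ← hz, rotTo_rotFrom, hz, add_comm (Real.sqrt (1 - β) • hub k v)]
    exact perp_add_smul_of_inner_eq_zero hh (by rw [real_inner_smul_left, huh, mul_zero]) _

end LiftVec

section Triv

variable (hk : 2 ≤ k) (hc : IsParam c) (v : Fin 8) {ε : ℝ} (hε : 0 < ε) (hεR : ε < rsq c)
include hk hc hε hεR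

/-- **The vertex trivialisation**: the vertex piece of the level in the `v`-th tube is
homeomorphic to `B̂ᵥ × S^{k-1}` (`S^{k-1}` realised as the great sphere orthogonal to the hub).
[folklore] -/
def vertexTriv : ↥(hatS k c v ε) ≃ₜ ↥(goodBase k v ε) × ↥(greatSphere (hub k v)) where
  toFun x := (⟨x.1.1, x.2.1⟩, ⟨fibCoord k v x.1, fibCoord_mem v (add_hub_ne_zero v hε.le x.2.1)
      (by rw [x.2.2.2]; exact levelRad_pos hc v hε (lt_capA hk hc v hεR x.2.1))⟩)
  invFun y := ⟨(y.1.1, ⟨liftVec k c v ε y.1.1 y.2.1, by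
      rw [mem_sphere_zero_iff_norm]; exact (liftVec_spec hk hc v hε hεR y.1.2 y.2.2).1⟩), by
    obtain ⟨hn, hin, hgt, _⟩ := liftVec_spec hk hc v hε hεR y.1.2 y.2.2
    have hR1 : rsq c ≤ 1 := by rw [rsq]; nlinarith [hc.nonneg]
    have hβR := levelRad_lt_rsq hc v hε (lt_capA hk hc v hεR y.1.2)
    refine ⟨y.1.2, ?_, ?_⟩
    · change c < ⟪(y.1.1 : 𝔼 (k + 1)), liftVec k c v ε y.1.1 y.2.1⟫
      rw [hin]; exact hgt
    · change 1 - ⟪(y.1.1 : 𝔼 (k + 1)), liftVec k c v ε y.1.1 y.2.1⟫ ^ 2 = levelRad k c v ε y.1.1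
      rw [hin, Real.sq_sqrt (by linarith)]
      ring⟩
  left_inv x := by
    obtain ⟨hp, htube, hb⟩ := x.2
    have h0 := add_hub_ne_zero v hε.le hp
    have hcap := lt_capA hk hc v hεR hp
    have hβpos : 0 < levelRad k c v ε x.1.1 := levelRad_pos hc v hε hcap
    have hbpos : 0 < bFn x.1 := by rw [hb]; exact hβpos
    ext1; refine Prod.ext rfl ?_; ext1
    change liftVec k c v ε x.1.1 (fibCoord k v x.1) = (x.1.2 : 𝔼 (k + 1))
    rw [liftVec]
    -- the vector `√(1-β) h + √β u` is `w = rotTo p h q`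
    set w := rotTo (x.1.1 : 𝔼 (k + 1)) (hub k v) x.1.2 with hw
    have h1 : Real.sqrt (levelRad k c v ε x.1.1) • fibCoord k v x.1 = perp (hub k v) w := by
      rw [fibCoord, smul_smul, ← hb, mul_inv_cancel₀ (Real.sqrt_pos.2 hbpos).ne', one_smul]
    have h2 : Real.sqrt (1 - levelRad k c v ε x.1.1) = ⟪w, hub k v⟫ := by
      rw [← hb, bFn_apply, hw, inner_rotTo_hub v h0]
      rw [show 1 - (1 - fibHt x.1 ^ 2) = fibHt x.1 ^ 2 by ring, Real.sqrt_sq (hc.nonneg.trans htube.le)]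
    rw [h1, h2, add_comm (⟪w, hub k v⟫ • hub k v), perp_add_smul, hw, rotFrom_rotTo]
  right_inv y := by
    obtain ⟨hn, hin, hgt, hperp⟩ := liftVec_spec hk hc v hε hεR y.1.2 y.2.2
    have hcap := lt_capA hk hc v hεR y.1.2
    have hβpos : 0 < levelRad k c v ε y.1.1 := levelRad_pos hc v hε hcap
    have hR1 : rsq c ≤ 1 := by rw [rsq]; nlinarith [hc.nonneg]
    have hβR := levelRad_lt_rsq hc v hε hcap
    have hb : bFn ((y.1.1, ⟨liftVec k c v ε y.1.1 y.2.1, by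
        rw [mem_sphere_zero_iff_norm]; exact hn⟩) : (𝕊 k) × (𝕊 k)) = levelRad k c v ε y.1.1 := by
      rw [bFn_apply, fibHt_apply]
      change 1 - ⟪(y.1.1 : 𝔼 (k + 1)), liftVec k c v ε y.1.1 y.2.1⟫ ^ 2 = _
      rw [hin, Real.sq_sqrt (by linarith)]
      ring
    refine Prod.ext rfl ?_
    ext1
    change fibCoord k v (y.1.1, ⟨liftVec k c v ε y.1.1 y.2.1, _⟩) = (y.2.1 : 𝔼 (k + 1))
    rw [fibCoord, hb]
    simp only
    rw [hperp, smul_smul, inv_mul_cancel₀ (Real.sqrt_pos.2 hβpos).ne', one_smul]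
  continuous_toFun := by
    refine Continuous.prodMk (Continuous.subtype_mk (continuous_fst.comp continuous_subtype_val) _)
      (Continuous.subtype_mk ?_ _)
    -- continuity of the fibre coordinate on `hatS`
    rw [continuous_iff_continuousAt]
    intro x
    obtain ⟨hp, htube, hb⟩ := x.2
    have h0 := add_hub_ne_zero v hε.le hp
    have hbpos : 0 < bFn x.1 := by rw [hb]; exact levelRad_pos hc v hε (lt_capA hk hc v hεR hp)
    have hrot : ContinuousAt (fun pq : (𝕊 k) × (𝕊 k) => rotTo (pq.1 : 𝔼 (k + 1)) (hub k v) pq.2) x.1 := by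
      have h := (contDiffAt_rotTo (n := 0) (y := ((x.1.1 : 𝔼 (k + 1)), (x.1.2 : 𝔼 (k + 1))))
        contDiffAt_fst contDiffAt_const contDiffAt_snd h0 (hub_ne_zero v)).continuousAt
      exact ContinuousAt.comp (f := fun pq : (𝕊 k) × (𝕊 k) => ((pq.1 : 𝔼 (k + 1)), (pq.2 : 𝔼 (k + 1))))
        (x := x.1) h (by fun_prop)
    have hF : ContinuousAt (fibCoord k v) x.1 := by
      unfold fibCoord
      refine ContinuousAt.fun_smul ?_ ((continuous_perp (hub k v)).continuousAt.comp hrot)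
      exact ContinuousAt.inv₀ (continuous_bFn.sqrt.continuousAt) (Real.sqrt_pos.2 hbpos).ne'
    exact hF.comp continuous_subtype_val.continuousAt
  continuous_invFun := by
    refine Continuous.subtype_mk (Continuous.prodMk (continuous_subtype_val.comp continuous_fst)
      (Continuous.subtype_mk ?_ _)) _
    -- continuity of `liftVec` on `goodBase × greatSphere`
    rw [continuous_iff_continuousAt]
    intro y
    have hp := y.1.2
    have h0 := add_hub_ne_zero v hε.le hp
    have hcap := lt_capA hk hc v hεR hp
    have hβ : ContinuousAt (fun y : ↥(goodBase k v ε) × ↥(greatSphere (hub k v)) => levelRad k c v ε y.1.1) y :=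
      ContinuousAt.comp (f := fun y : ↥(goodBase k v ε) × ↥(greatSphere (hub k v)) => (y.1.1 : 𝕊 k)) (x := y)
        (continuousAt_levelRad hc v hε hcap) (continuous_subtype_val.comp continuous_fst).continuousAt
    have hz : ContinuousAt (fun y : ↥(goodBase k v ε) × ↥(greatSphere (hub k v)) =>
        Real.sqrt (1 - levelRad k c v ε y.1.1) • hub k v + Real.sqrt (levelRad k c v ε y.1.1) • (y.2.1 : 𝔼 (k + 1))) y :=
      ((continuousAt_const.sub hβ).sqrt.fun_smul continuousAt_const).fun_add
        (hβ.sqrt.fun_smul (continuous_subtype_val.comp continuous_snd).continuousAt)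
    have hp1 : Continuous fun y : ↥(goodBase k v ε) × ↥(greatSphere (hub k v)) => ((y.1.1 : 𝕊 k) : 𝔼 (k + 1)) := by
      fun_prop
    have h := (contDiffAt_rotFrom (n := 0) (F := 𝔼 (k + 1) × 𝔼 (k + 1)) (y := ((y.1.1 : 𝔼 (k + 1)),
      Real.sqrt (1 - levelRad k c v ε y.1.1) • hub k v + Real.sqrt (levelRad k c v ε y.1.1) • (y.2.1 : 𝔼 (k + 1))))
      contDiffAt_fst contDiffAt_const contDiffAt_snd h0 (hub_ne_zero v)).continuousAt
    exact ContinuousAt.comp (f := fun y : ↥(goodBase k v ε) × ↥(greatSphere (hub k v)) =>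
      ((y.1.1 : 𝔼 (k + 1)), Real.sqrt (1 - levelRad k c v ε y.1.1) • hub k v +
        Real.sqrt (levelRad k c v ε y.1.1) • (y.2.1 : 𝔼 (k + 1)))) (x := y) h
      (hp1.continuousAt.prodMk hz)

end Triv

/-- **The good base region is simply connected** (`k ≥ 3`, `0 < ε ≤ 1/4`): it is the sphere minus
the `≤ 3` closed caps of height `√(1 - ε)` around the active poles, which are separated at height
`1/2` (the poles are orthonormal). [folklore] -/
theorem isSimplyConnected_goodBase (hk : 3 ≤ k) (v : Fin 8) {ε : ℝ} (hε : 0 < ε) (hε4 : ε ≤ 1 / 4) :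
    IsSimplyConnected (goodBase k v ε) := by
  set T : Finset (Fin 8) := Finset.univ.filter (fun w => kosinskiGamma8 v w = 1) with hT
  set u : Fin 8 → 𝕊 k := fun w => pole k (ecol v w).val with hu
  have hh : (1 / 2 : ℝ) < Real.sqrt (1 - ε) := by
    rw [show (1 / 2 : ℝ) = Real.sqrt (1 / 4) by
      rw [show (1 / 4 : ℝ) = (1 / 2) ^ 2 by norm_num, Real.sqrt_sq (by norm_num)]]
    exact Real.sqrt_lt_sqrt (by norm_num) (by linarith)
  have hh1 : Real.sqrt (1 - ε) < 1 := by
    rw [Real.sqrt_lt' one_pos]; linarith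
  have hsq : Real.sqrt (1 - ε) ^ 2 = 1 - ε := Real.sq_sqrt (by linarith)
  have key := isSimplyConnected_forall_inner_lt (E := 𝔼 (k + 1)) (n := k) hk T u
    (h' := 1 / 2) (h := Real.sqrt (1 - ε)) (by norm_num) hh hh1 ?_
  · convert key using 1
    ext q
    simp only [goodBase, hT, hu, Finset.mem_filter, Finset.mem_univ, true_and, mem_setOf_eq]
  · intro w hw w' hw' hww' q hq
    rw [hT, Finset.mem_filter] at hw hw'
    have hcol : ecol v w ≠ ecol v w' := fun h => hww' (ecol_injective_of_edge hw.2 hw'.2 h)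
    have horth := inner_pole_pole_of_ne (by omega : 2 ≤ k) hcol
    have hb := sq_inner_add_sq_inner_le (norm_eq_of_mem_sphere (pole k (ecol v w).val))
      (norm_eq_of_mem_sphere (pole k (ecol v w').val)) horth (q : 𝔼 (k + 1))
    rw [norm_eq_of_mem_sphere q, one_pow] at hb
    change (1 / 2 : ℝ) < ⟪(q : 𝔼 (k + 1)), (pole k (ecol v w).val : 𝔼 (k + 1))⟫ at hq
    change ⟪(q : 𝔼 (k + 1)), (pole k (ecol v w').val : 𝔼 (k + 1))⟫ < Real.sqrt (1 - ε)
    by_contra hge; push Not at hge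
    have h0 : 0 ≤ Real.sqrt (1 - ε) := Real.sqrt_nonneg _
    nlinarith

/-- **The vertex piece in the tube is simply connected** (`k ≥ 3`, `0 < ε ≤ 1/4`, `ε < r²`).
[folklore] -/
theorem isSimplyConnected_hatS (hk : 3 ≤ k) (hc : IsParam c) (v : Fin 8) {ε : ℝ} (hε : 0 < ε)
    (hε4 : ε ≤ 1 / 4) (hεR : ε < rsq c) : IsSimplyConnected (hatS k c v ε) := by
  haveI : SimplyConnectedSpace ↥(goodBase k v ε) := isSimplyConnected_goodBase hk v hε hε4
  haveI : SimplyConnectedSpace ↥(greatSphere (hub k v)) :=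
    simplyConnectedSpace_greatSphere (E := 𝔼 (k + 1)) (n := k) hk (hub_ne_zero v)
  haveI : SimplyConnectedSpace (↥(goodBase k v ε) × ↥(greatSphere (hub k v))) := simplyConnectedSpace_prod
  exact (vertexTriv (by omega : 2 ≤ k) hc v hε hεR).toHomotopyEquiv.simplyConnectedSpace_iff.2 ‹_›

end Vertex

/-! ### §2 The square piece -/

section Square

variable (k c) in
/-- **The square piece of the level** in the tube at the pole `e`:
`{(p, q) ∈ D_e(c) | a > ε, b > ε, G(a, b) = ε}`. [folklore] -/
def sqS (e : 𝕊 k) (ε : ℝ) : Set ((𝕊 k) × (𝕊 k)) :=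
  {pq | pq ∈ plumbDom e c ∧ ε < aFn e pq ∧ ε < bFn pq ∧ cornerFn (rsq c) bandSlope (aFn e pq, bFn pq) = ε}

variable (c) in
/-- The parameter interval `J = {a | ε < a < r², β(a) > ε}` of the square piece. [folklore] -/
def Jset (ε : ℝ) : Set ℝ := {a | ε < a ∧ a < rsq c ∧ ε < betaFn c ε a}

/-- `J` is order connected (`β` is antitone). [folklore] -/
theorem ordConnected_Jset {ε : ℝ} (hε : 0 < ε) : (Jset c ε).OrdConnected := by
  refine ⟨fun a₁ ha₁ a₂ ha₂ a ha => ⟨ha₁.1.trans_le ha.1, ha.2.trans_lt ha₂.2.1, ?_⟩⟩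
  exact ha₂.2.2.trans_le (betaFn_antitoneOn hε ⟨ha₁.1.trans_le ha.1, (ha.2.trans_lt ha₂.2.1).le⟩
    ⟨ha₂.1, ha₂.2.1.le⟩ ha.2)

/-- `J` is nonempty (`lt_betaFn_wedgePt`). [folklore] -/
theorem Jset_nonempty {ε : ℝ} (hε : 0 < ε) (hεR : ε < rsq c) : (Jset c ε).Nonempty :=
  ⟨_, lt_betaFn_wedgePt hε hεR⟩

/-- `J` is path connected. [folklore] -/
theorem isPathConnected_Jset {ε : ℝ} (hε : 0 < ε) (hεR : ε < rsq c) : IsPathConnected (Jset c ε) :=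
  ((ordConnected_Jset hε).convex (𝕜 := ℝ)).isPathConnected (Jset_nonempty hε hεR)

/-- `J ⊆ (ε, r²]`. [folklore] -/
theorem Jset_subset {ε : ℝ} : Jset c ε ⊆ Ioc ε (rsq c) := fun _ ha => ⟨ha.1, ha.2.1.le⟩

/-- `‖√a • u‖ = √a` for a unit vector `u`. [folklore] -/
theorem norm_sqrt_smul {u : 𝔼 (k + 1)} (hu : ‖u‖ = 1) (a : ℝ) : ‖Real.sqrt a • u‖ = Real.sqrt a := by
  rw [norm_smul, Real.norm_of_nonneg (Real.sqrt_nonneg a), hu, mul_one]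

/-- **The parametrisation of the square piece** in polar coordinates:
`(a, u, u') ↦ (√a u, √β(a) u')`. [folklore] -/
def sqParam (c : ℝ) (e : 𝕊 k) {ε : ℝ} (hε : 0 < ε)
    (x : ↥(Jset c ε) × (↥(greatSphere (e : 𝔼 (k + 1))) × ↥(greatSphere (e : 𝔼 (k + 1))))) :
    ↥(kapTarget k e (Real.sqrt (1 - c ^ 2))) :=
  ⟨(Real.sqrt x.1.1 • (x.2.1.1 : 𝔼 (k + 1)), Real.sqrt (betaFn c ε x.1.1) • (x.2.2.1 : 𝔼 (k + 1))), by
    obtain ⟨ha, haR, _⟩ := x.1.2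
    have hβR := betaFn_lt_rsq hε ha haR.le
    refine ⟨?_, ?_, ?_, ?_⟩
    · rw [real_inner_smul_left, x.2.1.2.2, mul_zero]
    · rw [real_inner_smul_left, x.2.2.2.2, mul_zero]
    · simp only
      rw [norm_sqrt_smul x.2.1.2.1, ← rsq]
      exact Real.sqrt_lt_sqrt (hε.le.trans ha.le) haR
    · simp only
      rw [norm_sqrt_smul x.2.2.2.1, ← rsq]
      exact Real.sqrt_lt_sqrt (betaFn_pos hε ha haR.le).le hβR⟩

section Param

variable (e : 𝕊 k) {ε : ℝ} (hε : 0 < ε)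
include hε

/-- `coe_sqParam` (coe sqParam). [folklore] -/
theorem coe_sqParam (x : ↥(Jset c ε) × (↥(greatSphere (e : 𝔼 (k + 1))) × ↥(greatSphere (e : 𝔼 (k + 1))))) :
    (sqParam c e hε x : 𝔼 (k + 1) × 𝔼 (k + 1)) =
      (Real.sqrt x.1.1 • (x.2.1.1 : 𝔼 (k + 1)), Real.sqrt (betaFn c ε x.1.1) • (x.2.2.1 : 𝔼 (k + 1))) := rfl

/-- `continuous_sqParam` (continuous sqParam). [folklore] -/
theorem continuous_sqParam : Continuous (sqParam c e hε) := by
  refine Continuous.subtype_mk (Continuous.prodMk ?_ ?_) _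
  · exact ((continuous_subtype_val.comp continuous_fst).sqrt).smul
      (continuous_subtype_val.comp (continuous_fst.comp continuous_snd))
  · have hβ : Continuous fun x : ↥(Jset c ε) => betaFn c ε x.1 := by
      have := (continuousOn_betaFn (c := c) hε).mono Jset_subset
      rw [continuousOn_iff_continuous_restrict] at this
      exact this
    exact ((hβ.comp continuous_fst).sqrt).smul (continuous_subtype_val.comp (continuous_snd.comp continuous_snd))

/-- **The square piece is the image of the parametrisation** under the inverse polar chart.
[folklore] -/
theorem sqS_eq_range (hc : IsParam c) :
    sqS k c e ε = range (fun x => unkap e (sqrt_one_sub_sq_le_one c) (sqParam c e hε x)) := by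
  have he := norm_eq_of_mem_sphere e
  have hR1 : rsq c ≤ 1 := by rw [rsq]; nlinarith [hc.nonneg]
  ext pq
  constructor
  · rintro ⟨hdom, ha, hb, hG⟩
    set a := aFn e pq with ha_def
    set b := bFn pq with hb_def
    have haR : a < rsq c := aFn_lt e hc.nonneg hdom.1
    have hbR : b < rsq c := bFn_lt hc.nonneg hdom.2
    have hbs : b < sbound c a := lt_sbound_of_cornerFn_lt (by linarith) (by rw [hG]; exact ha)
    have hbβ : b = betaFn c ε a := eq_betaFn hε ha haR.le ⟨bFn_nonneg pq, hbs⟩ hG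
    have hapos : 0 < a := hε.trans ha
    have hbpos : 0 < b := hε.trans hb
    have hb1 : -1 < baseHt e pq := by linarith [hdom.1, hc.nonneg]
    have hx : ‖kapFst e pq‖ = Real.sqrt a := by
      rw [← Real.sqrt_sq (norm_nonneg (kapFst e pq)), norm_kapFst_sq, ha_def, aFn_apply]
    have hy : ‖kapSnd e pq‖ = Real.sqrt b := by
      rw [← Real.sqrt_sq (norm_nonneg (kapSnd e pq)), norm_kapSnd_sq e hb1, hb_def, bFn_apply]
    have hsa : 0 < Real.sqrt a := Real.sqrt_pos.2 hapos
    have hsb : 0 < Real.sqrt b := Real.sqrt_pos.2 hbpos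
    set u : 𝔼 (k + 1) := (Real.sqrt a)⁻¹ • kapFst e pq with hu
    set u' : 𝔼 (k + 1) := (Real.sqrt b)⁻¹ • kapSnd e pq with hu'
    have humem : u ∈ greatSphere (e : 𝔼 (k + 1)) := by
      refine ⟨?_, ?_⟩
      · rw [hu, norm_smul, norm_inv, Real.norm_of_nonneg hsa.le, hx, inv_mul_cancel₀ hsa.ne']
      · rw [hu, real_inner_smul_left, inner_kapFst_pole, mul_zero]
    have hu'mem : u' ∈ greatSphere (e : 𝔼 (k + 1)) := by
      refine ⟨?_, ?_⟩
      · rw [hu', norm_smul, norm_inv, Real.norm_of_nonneg hsb.le, hy, inv_mul_cancel₀ hsb.ne']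
      · rw [hu', real_inner_smul_left, inner_kapSnd_pole, mul_zero]
    refine ⟨(⟨a, ha, haR, by rw [← hbβ]; exact hb⟩, ⟨u, humem⟩, ⟨u', hu'mem⟩), ?_⟩
    have hpar : sqParam c e hε (⟨a, ha, haR, by rw [← hbβ]; exact hb⟩, ⟨u, humem⟩, ⟨u', hu'mem⟩) =
        ⟨kap e pq, kap_mem_kapTarget e hc.nonneg hdom⟩ := by
      ext1
      rw [coe_sqParam]
      refine Prod.ext ?_ ?_
      · simp only [kap_fst]
        rw [hu, smul_smul, mul_inv_cancel₀ hsa.ne', one_smul]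
      · simp only [kap_snd]
        rw [← hbβ, hu', smul_smul, mul_inv_cancel₀ hsb.ne', one_smul]
    simp only
    rw [hpar, unkap_kap e hc.nonneg hdom]
  · rintro ⟨x, rfl⟩
    obtain ⟨ha, haR, hβ⟩ := x.1.2
    set xy := sqParam c e hε x with hxy
    have hmem := unkap_mem_plumbDom e hc.nonneg hc.lt_one xy
    have hnx : ‖xy.1.1‖ ^ 2 = x.1.1 := by
      rw [hxy, coe_sqParam]; simp only
      rw [norm_sqrt_smul x.2.1.2.1, Real.sq_sqrt (hε.le.trans ha.le)]
    have hny : ‖xy.1.2‖ ^ 2 = betaFn c ε x.1.1 := by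
      rw [hxy, coe_sqParam]; simp only
      rw [norm_sqrt_smul x.2.2.2.1, Real.sq_sqrt (betaFn_pos hε ha haR.le).le]
    have hβR := betaFn_lt_rsq hε ha haR.le
    have haFn : aFn e (unkap e (sqrt_one_sub_sq_le_one c) xy) = x.1.1 := by
      rw [aFn_apply, baseHt_unkap, hnx, Real.sq_sqrt (by linarith)]; ring
    have hbFn : bFn (unkap e (sqrt_one_sub_sq_le_one c) xy) = betaFn c ε x.1.1 := by
      rw [bFn_apply, fibHt_unkap, hny, Real.sq_sqrt (by linarith)]; ring
    refine ⟨hmem, ?_, ?_, ?_⟩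
    · rw [haFn]; exact ha
    · rw [hbFn]; exact hβ
    · rw [haFn, hbFn]; exact cornerFn_betaFn hε ha haR.le

/-- **The square piece is path connected** (`k ≥ 2`, `0 < ε < r²`). [folklore] -/
theorem isPathConnected_sqS (hk : 2 ≤ k) (hc : IsParam c) (hεR : ε < rsq c) : IsPathConnected (sqS k c e ε) := by
  haveI : PathConnectedSpace ↥(Jset c ε) := isPathConnected_iff_pathConnectedSpace.1 (isPathConnected_Jset hε hεR)
  haveI : PathConnectedSpace ↥(greatSphere (e : 𝔼 (k + 1))) :=
    isPathConnected_iff_pathConnectedSpace.1 (isPathConnected_greatSphere (n := k) hk (coe_sphere_ne_zero e))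
  rw [sqS_eq_range e hε hc]
  exact isPathConnected_range ((continuous_unkap e _).comp (continuous_sqParam e hε))

end Param

end Square

end Plumbing


end Literature.Topology.FourManifolds
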